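import Mathlib
import Summits.ResolutionOfSingularities.ResolutionOfSingularities.Theorems.WildQuotientsWildQuotientResolutionReesChartTheta
import HarnessLib

/-!
# The twist engine, inverse-`θ` form: a Rees chart ring localised at `θ ↦ Q⁻¹`, read through a twisted root chart `ψ` with `ψT = lᴺQʳ`, is `E[1/Q]`

(crux stmt-ResolutionOfSingularities-15640 `WildQuotients.WildQuotientResolution`, line `Sketch`;
chain w45c RUNG V5 HP₁ (res-L1-w45c-plan-1 NAMED 2026-08-27T11:35:13Z: stub-1 = the T2-analogue
`eE`); GENERALISATION of res-L1-w45c-stub-2's V4U twist engine `JordanFour.exists_ringEquiv_of_twistData`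
(p50xxxx, `…JordanFourTwistEngine`: exponent `6`, `ψT = s⁶Q`, `θ ↦ Q`, the even generator set) to an
ARBITRARY exponent `N`, `Q`-power `r`, generator set `S`, and the inverse orientation `θ ↦ Q⁻¹` forced
at the higher vertices (`J₅`, `μ₃`-vertex: `T = H′²`, `ψ₅T = l¹²Q²`, `H₃ = T′²H′`, `ψ₅H₃ = l²⁴Q³`,
`θ = T′²/H′³ ↦ 1/Q`). [OURS · L1 W4.5c] — NOT a statement of any manuscript (Hironaka 2017 is
consumed nowhere); replaces the role of no printed item. Prover res-L1-w45c-stub-1. AI-written Lean,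
kernel-checked; weaker than expert review.)

`exists_ringEquiv_of_twistData_inv`: `I = (g_j) ⊆ R = k[x]`, `T ∈ I`, `H₃ ∈ I²`, `B = (R[It])_{(Tt)}`,
`θ = (H₃t²)/(Tt)²`, `C` any localisation of `B` at `θ`; a twist datum `ψ : R → R` (injective
`k`-algebra map) with `ψT = lᴺQʳ`, `ψH₃ · Q = (lᴺQʳ)²`, `ψg_j = lᴺq_j`; a set `S ⊆ R` with
`q_j, ψxᵢ, Q ∈ k[S]` and an inverse dictionary `∀ t ∈ S, ∃ μ e e′ F, F ∈ I^μ ∧ ψF·Q^{e′} =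
t·(lᴺQʳ)^μ·Q^e` (slots `l = x_b`, `A = x_a`, `η₁ = x_d`, `Q = 1 − 3lA + A²η₁`). Then
`C ≃+* E_Q := k[S][1/Q] ⊆ R[1/Q]` with `F/1 ↦ ψF`, `(g_jt)/(Tt) ↦ q_j/Qʳ`, `θ ↦ Q⁻¹`.
Proof = the V4U engine verbatim with the bookkeeping of `Q`-powers adjusted (extend `ψ` to an
injective `R[1/T] → R[1/(lQ)]`, restrict to the affine blow-up algebra `R[I/T] ≅ B`, extend over
`θ ↦ Q⁻¹`, identify the image).
-/

-- single-problem summit: the doubled namespace component `ResolutionOfSingularities` is forced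
set_option linter.dupNamespace false

noncomputable section

open MvPolynomial IsLocalization Polynomial HomogeneousLocalization Literature.AlgebraicGeometry.Resolution

namespace Summit.ResolutionOfSingularities.ResolutionOfSingularities.Theorems.WildQuotientResolution.JordanFive

section TwistEngine

variable (k : Type) [Field k] (n : ℕ) (a b d : Fin n) {m : ℕ} (g : Fin m → MvPolynomial (Fin n) k)
  (T : MvPolynomial (Fin n) k) (hT : T ∈ Ideal.span (Set.range g)) (H₃ : MvPolynomial (Fin n) k)
  (hH₃ : H₃ ∈ Ideal.span (Set.range g) ^ 2)

local notation3 "Ig" => Ideal.span (Set.range g)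
local notation3 "Qp" => (1 - 3 * X b * X a + X a ^ 2 * X d : MvPolynomial (Fin n) k)
local notation3 "Bg" => HomogeneousLocalization.Away (reesGrading Ig) (reesT T hT)
local notation3 "φg" => reesChartBase (I := Ig) T hT
local notation3 "LQ" => Localization.Away Qp

local notation3 (prettyPrint := false) "θg" =>
  HomogeneousLocalization.Away.mk (reesGrading Ig) (reesT_mem T hT) 2
    (⟨monomial 2 H₃, reesAlgebra.monomial_mem.mpr hH₃⟩ : reesAlgebra Ig)
    (JordanFour.monomial_two_mem_reesGrading k n g H₃ hH₃)

-- the bookkeeping of units in three localisations is individually cheap but long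
set_option maxHeartbeats 1600000 in
/-- **The twist engine, inverse-`θ` form.** Let `I = (g₁,…,g_m) ⊆ R = k[x]`, `T ∈ I`, `H₃ ∈ I²`,
`B = (R[It])_{(Tt)}`, `θ = (H₃t²)/(Tt)² ∈ B`, `C` ANY localisation of `B` at `θ`. Let `ψ : R → R` be an
injective `k`-algebra map with `ψ T = x_bᴺ Q^r`, `ψ H₃ · Q = (x_bᴺ Q^r)²` (so `θ ↦ Q⁻¹`),
`ψ g_j = x_bᴺ q_j`; let `S ⊆ R` with `q_j ∈ k[S]`, `ψ xᵢ ∈ k[S]`, `Q ∈ k[S]`, and an inverse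
dictionary: every `t ∈ S` satisfies `ψ(F) Q^{e′} = t (x_bᴺQ^r)^μ Q^e` for some `F ∈ I^μ`. Then
`C ≃+* E_Q = k[S][1/Q] ⊆ R[1/Q]`, carrying `F/1 ↦ ψF`, `(g_jt)/(Tt) ↦ q_j · (Q⁻¹)^r`, `θ ↦ Q⁻¹`.
[OURS · L1 W4.5c] [folklore] -/
theorem exists_ringEquiv_of_twistData_inv (N r : ℕ)
    (ψ : MvPolynomial (Fin n) k →ₐ[k] MvPolynomial (Fin n) k) (hψinj : Function.Injective ψ)
    (hψT : ψ T = X b ^ N * Qp ^ r) (hψH3 : ψ H₃ * Qp = (X b ^ N * Qp ^ r) ^ 2)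
    (q : Fin m → MvPolynomial (Fin n) k) (hq : ∀ j, ψ (g j) = X b ^ N * q j)
    (S : Set (MvPolynomial (Fin n) k))
    (hqE : ∀ j, q j ∈ Algebra.adjoin k S) (hψE : ∀ i, ψ (X i) ∈ Algebra.adjoin k S)
    (hQE : Qp ∈ Algebra.adjoin k S)
    (hdict : ∀ t ∈ S, ∃ (μ e e' : ℕ) (F : MvPolynomial (Fin n) k), F ∈ Ig ^ μ ∧
        ψ F * Qp ^ e' = t * (X b ^ N * Qp ^ r) ^ μ * Qp ^ e)
    (C : Type) [CommRing C] [Algebra Bg C] [IsLocalization.Away θg C] :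
    ∃ e : C ≃+* ↥(Algebra.adjoin k ((algebraMap (MvPolynomial (Fin n) k) LQ) '' S ∪
        {(IsLocalization.Away.invSelf Qp : LQ)})),
      (∀ F : MvPolynomial (Fin n) k,
        ((e ((algebraMap Bg C : Bg →+* C) (φg F)) : _) : LQ) =
          algebraMap (MvPolynomial (Fin n) k) LQ (ψ F)) ∧
      (∀ j : Fin m,
        ((e ((algebraMap Bg C : Bg →+* C) (HomogeneousLocalization.Away.mk (reesGrading Ig)
          (reesT_mem T hT) 1 (reesT (g j) (Ideal.mem_span_range_self (f := g) (x := j)))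
          (reesT_mem_one_smul g j))) : _) : LQ) =
          algebraMap (MvPolynomial (Fin n) k) LQ (q j) * IsLocalization.Away.invSelf Qp ^ r) ∧
      ((e ((algebraMap Bg C : Bg →+* C) (θg : Bg)) : _) : LQ) = IsLocalization.Away.invSelf Qp := by
  classical
  -- abstract the element `θ` (keeps unification cheap)
  set θ : Bg := θg with hθ
  set E : Subalgebra k (MvPolynomial (Fin n) k) := Algebra.adjoin k S with hE
  set EQ : Subalgebra k LQ := Algebra.adjoin k ((algebraMap (MvPolynomial (Fin n) k) LQ) '' S ∪
        {(IsLocalization.Away.invSelf Qp : LQ)}) with hEQ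
  have hψEall : ∀ F, ψ F ∈ E := JordanFour.map_mem_of_forall_X_mem k n ψ E hψE
  -- non-vanishing
  have hXb : (X b : MvPolynomial (Fin n) k) ≠ 0 := X_ne_zero b
  have hQ0 : Qp ≠ 0 := by
    intro h
    have h' := congrArg MvPolynomial.constantCoeff h
    simp [MvPolynomial.constantCoeff_X] at h'
  have hXQ0 : (X b * Qp : MvPolynomial (Fin n) k) ≠ 0 := mul_ne_zero hXb hQ0
  have hTp0 : T ≠ 0 := by
    intro h
    have h' : ψ T = 0 := by rw [h, map_zero]
    rw [hψT] at h'
    exact mul_ne_zero (pow_ne_zero N hXb) (pow_ne_zero r hQ0) h'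
  -- the three localisations `k[x][1/T]`, `k[x][1/(lQ)]`, `k[x][1/Q]`
  set L₁ := Localization.Away T with hL₁
  set ι₁ := algebraMap (MvPolynomial (Fin n) k) L₁ with hι₁
  set L' := Localization.Away (X b * Qp : MvPolynomial (Fin n) k) with hL'
  set ι' := algebraMap (MvPolynomial (Fin n) k) L' with hι'
  set ιQ := algebraMap (MvPolynomial (Fin n) k) LQ with hιQ
  have hι'inj : Function.Injective ι' :=
    IsLocalization.injective L' (M := Submonoid.powers (X b * Qp : MvPolynomial (Fin n) k))
      (Submonoid.powers_le.2 (mem_nonZeroDivisors_of_ne_zero hXQ0))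
  have huXQ : IsUnit (ι' (X b * Qp)) := IsLocalization.Away.algebraMap_isUnit _
  have huX : IsUnit (ι' (X b)) := by
    rw [map_mul] at huXQ; exact isUnit_of_mul_isUnit_left huXQ
  have huQ : IsUnit (ι' Qp) := by
    rw [map_mul] at huXQ; exact isUnit_of_mul_isUnit_right huXQ
  -- `j : k[x][1/Q] → k[x][1/(lQ)]`
  let j : LQ →+* L' := IsLocalization.Away.lift Qp (g := ι') huQ
  have hj : ∀ x, j (ιQ x) = ι' x := fun x => IsLocalization.Away.lift_eq Qp huQ x
  have hjinv : ι' Qp * j (IsLocalization.Away.invSelf Qp) = 1 := by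
    have h := congrArg j (IsLocalization.Away.mul_invSelf (S := LQ) Qp)
    rwa [map_mul, hj, map_one] at h
  have hjinj : Function.Injective j := by
    rw [injective_iff_map_eq_zero]
    intro z hz
    obtain ⟨⟨x, s⟩, hzr⟩ := IsLocalization.surj (Submonoid.powers (Qp)) z
    change z * ιQ s = ιQ x at hzr
    have hx : ι' x = 0 := by rw [← hj, ← hzr, map_mul, hz, zero_mul]
    have hx0 : x = 0 := hι'inj (by rw [hx, map_zero])
    rw [hx0, map_zero] at hzr
    exact (IsLocalization.map_units LQ s).mul_left_eq_zero.mp hzr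
  let jₐ : LQ →ₐ[k] L' :=
    { j with
      commutes' := fun t => by
        change j (algebraMap k LQ t) = algebraMap k L' t
        rw [IsScalarTower.algebraMap_apply k (MvPolynomial (Fin n) k) LQ, hj,
          ← IsScalarTower.algebraMap_apply] }
  have hjₐinj : Function.Injective jₐ := hjinj
  -- `h₀ : k[x][1/T] → k[x][1/(lQ)]` extending `ψ`
  have hgT : IsUnit ((ι'.comp ψ.toRingHom) T) := by
    change IsUnit (ι' (ψ T))
    rw [hψT, map_mul, map_pow, map_pow]
    exact (huX.pow N).mul (huQ.pow r)
  let h₀ : L₁ →+* L' := IsLocalization.Away.lift T hgT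
  have hh₀ι : ∀ x, h₀ (ι₁ x) = ι' (ψ x) := fun x => IsLocalization.Away.lift_eq T hgT x
  have e1 : ι' (X b) ^ N * ι' Qp ^ r * h₀ (IsLocalization.Away.invSelf T) = 1 := by
    have h1 : h₀ (ι₁ T * IsLocalization.Away.invSelf T) = 1 := by
      rw [IsLocalization.Away.mul_invSelf, map_one]
    rwa [map_mul h₀, hh₀ι, hψT, map_mul ι', map_pow ι', map_pow ι'] at h1
  have hh₀inj : Function.Injective h₀ := by
    rw [injective_iff_map_eq_zero]
    intro z hz
    obtain ⟨⟨x, s⟩, hzr⟩ := IsLocalization.surj (Submonoid.powers T) z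
    change z * ι₁ s = ι₁ x at hzr
    have hx : ψ x = 0 := by
      apply hι'inj
      rw [map_zero, ← hh₀ι, ← hzr, map_mul, hz, zero_mul]
    have hx0 : x = 0 := hψinj (by rw [hx, map_zero])
    rw [hx0, map_zero] at hzr
    exact (IsLocalization.map_units L₁ s).mul_left_eq_zero.mp hzr
  -- `Φ₀ : B_T → k[x][1/(lQ)]`
  let Φ₀ : Bg →+* L' := h₀.comp (reesChart T hT)
  have hΦ₀ : ∀ x, Φ₀ x = h₀ (reesChart T hT x) := fun x => rfl
  have hΦ₀inj : Function.Injective Φ₀ := hh₀inj.comp (reesChart_injective T hT)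
  have hΦ₀base : ∀ F, Φ₀ (φg F) = ι' (ψ F) := fun F => by
    rw [hΦ₀, reesChart_reesChartBase, ← hι₁, hh₀ι]
  -- `θ ↦ Q⁻¹`
  have hΦ₀θ : Φ₀ θ = j (IsLocalization.Away.invSelf Qp) := by
    have hval : Φ₀ θ = ι' (ψ H₃) * h₀ (IsLocalization.Away.invSelf T) ^ 2 := by
      rw [hΦ₀, hθ, JordanFour.reesChart_theta k n g T hT H₃ hH₃, map_mul h₀, ← hι₁, hh₀ι, map_pow h₀]
    have hprod : ι' Qp * Φ₀ θ = 1 := by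
      have h := congrArg ι' hψH3
      rw [map_mul ι', map_pow ι', map_mul ι', map_pow ι', map_pow ι'] at h
      rw [hval]
      calc ι' Qp * (ι' (ψ H₃) * h₀ (IsLocalization.Away.invSelf T) ^ 2)
          = (ι' (ψ H₃) * ι' Qp) * h₀ (IsLocalization.Away.invSelf T) ^ 2 := by ring
        _ = (ι' (X b) ^ N * ι' Qp ^ r) ^ 2 * h₀ (IsLocalization.Away.invSelf T) ^ 2 := by rw [h]
        _ = (ι' (X b) ^ N * ι' Qp ^ r * h₀ (IsLocalization.Away.invSelf T)) ^ 2 := by ring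
        _ = 1 := by rw [e1, one_pow]
    exact left_inv_eq_right_inv (by rw [mul_comm]; exact hprod) hjinv ▸ rfl
  have hΦ₀gen : ∀ j' : Fin m, Φ₀ (HomogeneousLocalization.Away.mk (reesGrading Ig) (reesT_mem T hT) 1
      (reesT (g j') (Ideal.mem_span_range_self (f := g) (x := j'))) (reesT_mem_one_smul g j')) =
      ι' (q j') * j (IsLocalization.Away.invSelf Qp) ^ r := by
    intro j'
    rw [hΦ₀, JordanFour.reesChart_chartGen k n g T hT, map_mul h₀, ← hι₁, hh₀ι, hq j', map_mul ι',
      map_pow ι']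
    -- `lᴺ q / (lᴺ Qʳ) = q Q⁻ʳ`
    have hQr : ι' Qp ^ r * j (IsLocalization.Away.invSelf Qp) ^ r = 1 := by
      rw [← mul_pow, hjinv, one_pow]
    calc ι' (X b) ^ N * ι' (q j') * h₀ (IsLocalization.Away.invSelf T)
        = ι' (q j') * (ι' (X b) ^ N * h₀ (IsLocalization.Away.invSelf T)) *
            (ι' Qp ^ r * j (IsLocalization.Away.invSelf Qp) ^ r) := by rw [hQr, mul_one]; ring
      _ = ι' (q j') * j (IsLocalization.Away.invSelf Qp) ^ r *
            (ι' (X b) ^ N * ι' Qp ^ r * h₀ (IsLocalization.Away.invSelf T)) := by ring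
      _ = ι' (q j') * j (IsLocalization.Away.invSelf Qp) ^ r := by rw [e1, mul_one]
  -- `Φ : C → k[x][1/(lQ)]`
  have hθu : IsUnit (Φ₀ θ) := by
    rw [hΦ₀θ]
    exact IsUnit.of_mul_eq_one_right _ hjinv
  let Φ : C →+* L' := IsLocalization.Away.lift θ hθu
  have hΦalg : ∀ x, Φ ((algebraMap Bg C : Bg →+* C) x) = Φ₀ x := fun x =>
    IsLocalization.Away.lift_eq θ hθu x
  have hΦinvθ : j (IsLocalization.Away.invSelf Qp) * Φ (IsLocalization.Away.invSelf θ) = 1 := by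
    have h := congrArg Φ (IsLocalization.Away.mul_invSelf (S := C) θ)
    rw [map_mul Φ, map_one Φ] at h
    rw [← hΦ₀θ, ← hΦalg]
    exact h
  have hΦinvθ' : Φ (IsLocalization.Away.invSelf θ) = ι' Qp :=
    left_inv_eq_right_inv (by rw [mul_comm]; exact hΦinvθ) (by rw [mul_comm]; exact hjinv)
  have hΦinj : Function.Injective Φ := by
    rw [injective_iff_map_eq_zero]
    intro z hz
    obtain ⟨⟨x, s⟩, hzr⟩ := IsLocalization.surj (Submonoid.powers θ) z
    change z * (algebraMap Bg C : Bg →+* C) s = (algebraMap Bg C : Bg →+* C) x at hzr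
    have hx : Φ₀ x = 0 := by rw [← hΦalg, ← hzr, map_mul Φ, hz, zero_mul]
    have hx0 : x = 0 := hΦ₀inj (by rw [hx, map_zero])
    rw [hx0, map_zero] at hzr
    exact (IsLocalization.map_units C s).mul_left_eq_zero.mp hzr
  -- membership helpers for `E_Q`
  have hιQE : ∀ x, x ∈ E → ιQ x ∈ EQ := by
    intro x hx
    refine Algebra.adjoin_induction (fun y hy => ?_) (fun t => ?_) (fun _ _ _ _ hx hy => ?_)
      (fun _ _ _ _ hx hy => ?_) hx
    · exact Algebra.subset_adjoin (Set.mem_union_left _ ⟨y, hy, rfl⟩)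
    · rw [← IsScalarTower.algebraMap_apply]
      exact Subalgebra.algebraMap_mem _ _
    · rw [map_add ιQ]; exact Subalgebra.add_mem _ hx hy
    · rw [map_mul ιQ]; exact Subalgebra.mul_mem _ hx hy
  have hinvQE : (IsLocalization.Away.invSelf Qp : LQ) ∈ EQ :=
    Algebra.subset_adjoin (Set.mem_union_right _ rfl)
  have hQEQ : ιQ Qp ∈ EQ := hιQE _ hQE
  have hmapj : ∀ w, w ∈ EQ → j w ∈ Subalgebra.map jₐ EQ := fun w hw => Subalgebra.mem_map.mpr ⟨w, hw, rfl⟩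
  -- (⊆) the image of `Φ` lies in `j(E_Q)`
  have hBlsub : ∀ y, y ∈ blowupAlgebra Ig T → h₀ y ∈ Subalgebra.map jₐ EQ := by
    intro y hy
    refine Algebra.adjoin_induction (fun y hy => ?_) (fun x => ?_) (fun _ _ _ _ hx hy => ?_)
      (fun _ _ _ _ hx hy => ?_) hy
    · obtain ⟨x, hx, rfl⟩ := hy
      refine Submodule.span_induction
        (p := fun x _ => h₀ (ι₁ x * IsLocalization.Away.invSelf T) ∈ Subalgebra.map jₐ EQ)
        ?_ ?_ ?_ ?_ hx
      · rintro _ ⟨j', rfl⟩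
        rw [map_mul h₀, hh₀ι, hq j', map_mul ι', map_pow ι']
        have hQr : ι' Qp ^ r * j (IsLocalization.Away.invSelf Qp) ^ r = 1 := by
          rw [← mul_pow, hjinv, one_pow]
        have key : ι' (X b) ^ N * ι' (q j') * h₀ (IsLocalization.Away.invSelf T) =
            j (ιQ (q j') * IsLocalization.Away.invSelf Qp ^ r) := by
          rw [map_mul j, hj, map_pow j]
          calc ι' (X b) ^ N * ι' (q j') * h₀ (IsLocalization.Away.invSelf T)
              = ι' (q j') * (ι' (X b) ^ N * h₀ (IsLocalization.Away.invSelf T)) *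
                  (ι' Qp ^ r * j (IsLocalization.Away.invSelf Qp) ^ r) := by rw [hQr, mul_one]; ring
            _ = ι' (q j') * j (IsLocalization.Away.invSelf Qp) ^ r *
                  (ι' (X b) ^ N * ι' Qp ^ r * h₀ (IsLocalization.Away.invSelf T)) := by ring
            _ = ι' (q j') * j (IsLocalization.Away.invSelf Qp) ^ r := by rw [e1, mul_one]
        rw [key]
        exact hmapj _ (Subalgebra.mul_mem _ (hιQE _ (hqE j')) (Subalgebra.pow_mem _ hinvQE r))
      · rw [map_zero ι₁, zero_mul, map_zero h₀]
        exact Subalgebra.zero_mem _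
      · intro x y _ _ hx hy
        rw [map_add ι₁, add_mul, map_add h₀]
        exact Subalgebra.add_mem _ hx hy
      · intro r' x _ hx
        rw [smul_eq_mul, map_mul ι₁, mul_assoc (ι₁ r') (ι₁ x) (IsLocalization.Away.invSelf T), map_mul h₀,
          hh₀ι, ← hj]
        exact Subalgebra.mul_mem _ (hmapj _ (hιQE _ (hψEall r'))) hx
    · change h₀ (ι₁ x) ∈ _
      rw [hh₀ι, ← hj]
      exact hmapj _ (hιQE _ (hψEall x))
    · rw [map_add h₀]; exact Subalgebra.add_mem _ hx hy
    · rw [map_mul h₀]; exact Subalgebra.mul_mem _ hx hy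
  have hsub : ∀ z : C, Φ z ∈ Subalgebra.map jₐ EQ := by
    intro z
    obtain ⟨⟨x, s⟩, hzr⟩ := IsLocalization.surj (Submonoid.powers θ) z
    obtain ⟨m', hm⟩ := s.2
    change z * (algebraMap Bg C : Bg →+* C) s = (algebraMap Bg C : Bg →+* C) x at hzr
    have hz : Φ z = Φ₀ x * Φ (IsLocalization.Away.invSelf θ) ^ m' := by
      have h1 := congrArg Φ hzr
      rw [map_mul Φ, hΦalg, hΦalg, ← hm, map_pow Φ₀, hΦ₀θ] at h1
      calc Φ z = Φ z * (j (IsLocalization.Away.invSelf Qp) * Φ (IsLocalization.Away.invSelf θ)) ^ m' := by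
            rw [hΦinvθ, one_pow, mul_one]
        _ = Φ z * j (IsLocalization.Away.invSelf Qp) ^ m' * Φ (IsLocalization.Away.invSelf θ) ^ m' := by
            ring
        _ = Φ₀ x * Φ (IsLocalization.Away.invSelf θ) ^ m' := by rw [h1]
    rw [hz, hΦinvθ', ← hj]
    refine Subalgebra.mul_mem _ ?_ (Subalgebra.pow_mem _ (hmapj _ hQEQ) m')
    have hxBl : reesChart T hT x ∈ blowupAlgebra Ig T := by
      have : reesChart T hT x ∈ Set.range (reesChart T hT) := ⟨x, rfl⟩
      rwa [range_reesChart T hT] at this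
    exact hBlsub _ hxBl
  -- elements of `C` from the affine blowup algebra, and their images
  have hcOf : ∀ (y : L₁) (hy : y ∈ blowupAlgebra Ig T),
      Φ ((algebraMap Bg C : Bg →+* C) ((reesChartEquiv T hT).symm ⟨y, hy⟩)) = h₀ y := by
    intro y hy
    rw [hΦalg, hΦ₀, ← coe_reesChartEquiv, RingEquiv.apply_symm_apply]
  have hmemBl : ∀ (μ : ℕ) (F : MvPolynomial (Fin n) k), F ∈ Ig ^ μ →
      ι₁ F * IsLocalization.Away.invSelf T ^ μ ∈ blowupAlgebra Ig T := fun μ F hF =>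
    algebraMap_mul_invSelf_pow_mem_blowupAlgebra T μ hF
  -- the dictionary: `ψ F · Q^{e'} = t (lᴺQʳ)^μ Q^e` gives `t = Φ (F/T^μ · (θ⁻¹)^{e'} · θ^{e})`
  have hdictC : ∀ (μ e e' : ℕ) (F t : MvPolynomial (Fin n) k) (hF : F ∈ Ig ^ μ),
      ψ F * Qp ^ e' = t * (X b ^ N * Qp ^ r) ^ μ * Qp ^ e →
      Φ ((algebraMap Bg C : Bg →+* C) ((reesChartEquiv T hT).symm ⟨_, hmemBl μ F hF⟩) *
        IsLocalization.Away.invSelf θ ^ e' * (algebraMap Bg C : Bg →+* C) θ ^ e) = ι' t := by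
    intro μ e e' F t hF hψF
    rw [map_mul Φ, map_mul Φ, map_pow Φ, map_pow Φ, hcOf, map_mul h₀, map_pow h₀, hh₀ι, hΦalg, hΦ₀θ,
      hΦinvθ']
    have h1 : ι' (ψ F) * ι' Qp ^ e' = ι' t * (ι' (X b) ^ N * ι' Qp ^ r) ^ μ * ι' Qp ^ e := by
      have h := congrArg ι' hψF
      simpa only [map_mul, map_pow] using h
    calc _ = (ι' (ψ F) * ι' Qp ^ e') * h₀ (IsLocalization.Away.invSelf T) ^ μ *
          j (IsLocalization.Away.invSelf Qp) ^ e := by ring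
      _ = ι' t * (ι' (X b) ^ N * ι' Qp ^ r * h₀ (IsLocalization.Away.invSelf T)) ^ μ *
          (ι' Qp * j (IsLocalization.Away.invSelf Qp)) ^ e := by rw [h1]; ring
      _ = ι' t := by rw [e1, hjinv, one_pow, one_pow, mul_one, mul_one]
  -- (⊇) every generator of `E_Q` is hit
  have hsup : ∀ w, w ∈ EQ → ∃ z : C, Φ z = j w := by
    intro w hw
    refine Algebra.adjoin_induction (fun y hy => ?_) (fun t => ?_) (fun _ _ _ _ hx hy => ?_)
      (fun _ _ _ _ hx hy => ?_) hw
    · rcases hy with ⟨x, hx, rfl⟩ | hy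
      · rw [hj]
        obtain ⟨μ, e, e', F, hF, hψF⟩ := hdict x hx
        exact ⟨_, hdictC μ e e' F x hF hψF⟩
      · rw [Set.mem_singleton_iff] at hy
        rw [hy]
        exact ⟨(algebraMap Bg C : Bg →+* C) θ, by rw [hΦalg, hΦ₀θ]⟩
    · refine ⟨(algebraMap Bg C : Bg →+* C) (φg (MvPolynomial.C t)), ?_⟩
      rw [hΦalg, hΦ₀base, IsScalarTower.algebraMap_apply k (MvPolynomial (Fin n) k) LQ, hj,
        MvPolynomial.algebraMap_eq, ← MvPolynomial.algebraMap_eq, AlgHom.commutes]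
    · obtain ⟨z₁, h₁⟩ := hx
      obtain ⟨z₂, h₂⟩ := hy
      exact ⟨z₁ + z₂, by rw [map_add Φ, h₁, h₂, map_add j]⟩
    · obtain ⟨z₁, h₁⟩ := hx
      obtain ⟨z₂, h₂⟩ := hy
      exact ⟨z₁ * z₂, by rw [map_mul Φ, h₁, h₂, map_mul j]⟩
  -- the isomorphism `C ≃ E_Q.map jₐ ≃ E_Q`
  let Φ' : C →+* ↥(Subalgebra.map jₐ EQ) := Φ.codRestrict (Subalgebra.map jₐ EQ).toSubring fun z => hsub z
  have hΦ' : Function.Bijective Φ' := by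
    refine ⟨fun z₁ z₂ h => hΦinj (congrArg Subtype.val h), fun y => ?_⟩
    obtain ⟨w, hw, hwy⟩ := Subalgebra.mem_map.mp y.2
    obtain ⟨z, hz⟩ := hsup w hw
    exact ⟨z, Subtype.ext (by rw [← hwy]; exact hz)⟩
  let e₁ : C ≃+* ↥(Subalgebra.map jₐ EQ) := RingEquiv.ofBijective Φ' hΦ'
  let e₂ : ↥(Subalgebra.map jₐ EQ) ≃+* ↥EQ := (Subalgebra.equivMapOfInjective EQ jₐ hjₐinj).symm.toRingEquiv
  have he : ∀ (z : C) (w : LQ) (hw : w ∈ EQ), Φ z = j w → ((e₁.trans e₂ z : EQ) : LQ) = w := by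
    intro z w hw hzw
    have hw' : j w ∈ Subalgebra.map jₐ EQ := hmapj w hw
    have h1 : e₁ z = ⟨j w, hw'⟩ := Subtype.ext hzw
    have h2 : (Subalgebra.equivMapOfInjective EQ jₐ hjₐinj) ⟨w, hw⟩ = ⟨j w, hw'⟩ :=
      Subtype.ext (Subalgebra.coe_equivMapOfInjective_apply EQ jₐ hjₐinj ⟨w, hw⟩)
    have h3 : e₂ ⟨j w, hw'⟩ = ⟨w, hw⟩ := by
      change (Subalgebra.equivMapOfInjective EQ jₐ hjₐinj).symm ⟨j w, hw'⟩ = ⟨w, hw⟩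
      rw [AlgEquiv.symm_apply_eq, h2]
    rw [RingEquiv.trans_apply, h1, h3]
  refine ⟨e₁.trans e₂, fun F => ?_, fun j' => ?_, ?_⟩
  · exact he _ _ (hιQE _ (hψEall F)) (by rw [hΦalg, hΦ₀base, hj])
  · exact he _ _ (Subalgebra.mul_mem _ (hιQE _ (hqE j')) (Subalgebra.pow_mem _ hinvQE r))
      (by rw [hΦalg, hΦ₀gen, map_mul j, hj, map_pow j])
  · exact he _ _ hinvQE (by rw [hΦalg, hΦ₀θ])

end TwistEngine

end Summit.ResolutionOfSingularities.ResolutionOfSingularities.Theorems.WildQuotientResolution.JordanFive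

end
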